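import Summits.QuantumFields.YangMills.Theorems.UnitScaleTiltMinimiserStabilityRegPrPV3E
import Summits.QuantumFields.YangMills.Theorems.UnitScaleTiltProp7ExistRouteAlphaMin
import HarnessLib

/-!
# Route `UnitScaleTilt`, crux K1 child «MinimiserStabilityRegPr» (stmt-QuantumFields-19200), skeleton v10, stub `stub_existenceMinimalOrbit`, route (α) — (S3)(ii) THE MINIMALITY
# HALF OF C-min ([Balaban1985Variational] (141)–(142) p. 299: «A second order differential at A′ = 0 … is positive definite. Hence A′ = 0 is a minimum»): the Prop-6 chart point
# `e^{iX}U₀` MINIMISES `X′ ↦ A(e^{iX′}U₀)` over the admissible `ε₄`-ball, FROM the per-competitor growth inputs (ii′) ∧ (iii′) at its axial representative — by name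

Cell `ym3-torus`, width seat `ym-ust-19200-w4` (gen 0; OWNER DE-CONFLICT 2026-08-28 01:54:24Z (3): «★w4 = (S3)(ii) the minimality half `growth142_T3` … state its conclusion VERBATIM as
the minimality clause of C-min's text (p593620's `hC`) so ★w2 g2's `Cmin_of_P6T3_chart_growth` consumes it by `exact`»).  THEOREMS ONLY (0 `def`, 0 `sorry`).  YM₃ on T³ is a ladder
rung (R3), not the Clay problem; nothing here claims the stub, the crux, d = 4 or the mass gap.

THE ROUTE (no new analysis).  Let `X` be Hermitian-traceless with `nMax19 X < ε₄ ≤ ¼` over a (14)-background `U₀ ∈ 𝔘_k(L³B₃ε₁)`, `L³B₃ε₁ ≤ ε₄`, and let `W := (e^{iX}U₀)^u` be an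
axial representative in the fibre `𝔅_k(V)` (as (20) `AvgCondPrint` provides).  (19) at `ε₄` (`Prop7PV3CDELogChart.in19_expHermField_of_nMax19_lt`) and row D's engine
(`Prop7B8Prop7Div.regPr_emb15_of_in19`, [Balaban1985RegularSpaces] Prop. 7 (1.144)) put `W` in print's regular fibre `(6)(178ε₄)`.  The DISPLAYED growth input `hrepr` — for every
competitor `W′ ∈ (6)(178ε₄) ∩ 𝔅_k(V)` ONE (4)-representative with (ii′) the relative-curvature Poincaré inequality and (iii′) the θ-form first-variation bound at the background `W`
(route (γ)'s P ∧ S_gen; `PV3E` §3) — makes `W` a minimiser over `(6)(178ε₄)` (`PV3E.isMinOn_regFibrePr_of_relSchemaThetaE_T3`).  A competitor `X′` of the chart ball (`nMax19 X′ < ε₄`,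
(20), (21)) is transported the same way (`u′` from `AvgCondPrint`, (19) at `ε₄`, row D's engine) into `(6)(178ε₄) ∩ 𝔅_k(V)`, and (5) is gauge invariant:
`A(e^{iX}U₀) = A(W) ≤ A(W′) = A(e^{iX′}U₀)`.

WHAT IS PROVED (ns `…Theorems.Prop7Growth142T3`).  ★ `growth142_T3` — conclusion VERBATIM the minimality clause of C-min (`Prop7ExistRouteAlphaMin.existenceMinimalOrbit_of_Cmin_cov`'s
`hC`): `∀ X′, nMax19 X′ < ε₄ → X′ Hermitian-traceless → AvgCondPrint V U₀ X′ → IsLandauPrint U₀ X′ → A(e^{iX}U₀) ≤ A(e^{iX′}U₀)`.  ((21) `IsLandauPrint` is not even used: the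
growth input compares against every regular competitor of the fibre, Landau or not.)  §2 (v1.1 append, gen 2) ★ `growth142_T3_full` — the same with the representative
UN-PINNED (`hreprFull`: `∃ g : GaugeTransf, (ii′) ∧ (iii′)`, no `g↓ = 1`), for the supply on the chord's full covariant Landau representative (OWNER RULING (HESS_W) 2026-08-28).

HONEST SCOPE.  Bookkeeping over `PV3E`, `Prop7B8Prop7Div`, `Prop7PV3CDELogChart` and the gauge invariance of (5); the growth input (ii′) ∧ (iii′) — [Balaban1985Variational] (142)'s
positivity + [Balaban1985RegularSpaces] Thm 2's covering, in the cell's sup-free letters — is DISPLAYED, not proved (its linearised-slice model is p1's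
`Prop7CovariantCoercivity.wilsonAction4_sub_background_ge_of_regPr_T3`); `--supports stmt-QuantumFields-19200`, count-neutral.

References: T. Bałaban, CMP 102 (1985) 277–309 [Balaban1985Variational] ((19)–(21) p.281, (112) p.294, Prop. 6 p.295, (141)–(142) p.299); CMP 99 (1985) 75–102
[Balaban1985RegularSpaces] (Prop. 7 (1.144) p.100, (1.47) p.84).
-/

set_option autoImplicit false

noncomputable section

open scoped BigOperators Matrix.Norms.L2Operator Matrix

namespace Summit.QuantumFields.YangMills.Theorems.Prop7Growth142T3

open Literature.MathematicalPhysics.QuantumFieldTheory.Balaban1983to89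
open Literature.MathematicalPhysics.QuantumFieldTheory.Balaban1983to89.T3ContinuumYM3Torus
open Literature.MathematicalPhysics.QuantumFieldTheory.Balaban1983to89.T3UnitLawDensityEML (ℰp)
open Literature.MathematicalPhysics.QuantumFieldTheory.Balaban1983to89.T3ConstrainedMinimiser (fibre)
open Literature.MathematicalPhysics.QuantumFieldTheory.Balaban1983to89.T3PrintedRegularMinimiser (RegPr regFibrePr mem_regFibrePr_iff)
open Literature.MathematicalPhysics.QuantumFieldTheory.Balaban1983to89.T3PrintedRegularOrbits (descTransf regPr_gaugeAct_iff)
open Literature.MathematicalPhysics.QuantumFieldTheory.Balaban1983to89.T3Thm1Carrier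
open Literature.MathematicalPhysics.QuantumFieldTheory.Balaban1983to89.T3SectALandauChart (In19 emb15 pos_of_regPr)
open BlockAveragingEMLLinearisedBackground (pertVar)
open Summit.QuantumFields.YangMills.Theorems.Prop7TPrint (nMax19 expHermField)
open Summit.QuantumFields.YangMills.Theorems.Prop7SPrint (AvgCondPrint IsLandauPrint)
open Summit.QuantumFields.YangMills.Theorems.Prop7PV3CDELogChart (in19_expHermField_of_nMax19_lt pos_of_in19)
open Summit.QuantumFields.YangMills.Theorems.Prop7B8Prop7Div (regPr_emb15_of_in19)
open Summit.QuantumFields.YangMills.Theorems.PV3E (isMinOn_regFibrePr_of_relSchemaThetaE_T3)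

/-- ★ **THE MINIMALITY HALF OF C-min, BY NAME FROM THE GROWTH INPUTS AT THE PROP-6 POINT.**  `U₀ ∈ 𝔘_k(L³B₃ε₁)`, `L³B₃ε₁ ≤ ε₄ ≤ ¼`; `X` Hermitian-traceless with `nMax19 X < ε₄`;
`W = (e^{iX}U₀)^u ∈ 𝔅_k(V)` an axial representative of the chart point (from (20)); `hrepr` = for every `W′ ∈ (6)(178ε₄) ∩ 𝔅_k(V)` one `g`, `g↓ = 1`, with (ii′) the relative-curvature
Poincaré inequality (`C_P`) and (iii′) `Lin_W(Y) ≥ −θ·Σ_p‖R_p − 1‖² − C_L·Σ‖Y‖²` at the background `W`; `κ = ((½ − θ)/C_P − 96·178ε₄)·L^{−2(K−n)} − C_L ≥ 0`.  THEN `e^{iX}U₀`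
minimises `X′ ↦ A(e^{iX′}U₀)` over the admissible `ε₄`-ball: VERBATIM the last clause of C-min. [cite: Balaban1985Variational, (141)-(142) p.299, Prop. 6 p.295, (19)-(21) p.281;
Balaban1985RegularSpaces, Prop. 7 (1.144) p.100] -/
theorem growth142_T3 (F : T3Family) {n K : ℕ} (hnK : n < K) {B₃ ε₁ ε₄ : ℝ} (hε₄ : ε₄ ≤ 1 / 4) (hlo : (F.L : ℝ) ^ 3 * B₃ * ε₁ ≤ ε₄)
    (V : GaugeField (F.P n) 0 (Matrix.specialUnitaryGroup (Fin 2) ℂ)) (U₀ : GaugeField (F.P K) 0 (Matrix.specialUnitaryGroup (Fin 2) ℂ))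
    (hreg : RegPr F n K ((F.L : ℝ) ^ 3 * B₃ * ε₁) U₀)
    (X : PBond (F.P K) 0 → Matrix (Fin 2) (Fin 2) ℂ) (hXh : ∀ b : PBond (F.P K) 0, (X b).IsHermitian ∧ Matrix.trace (X b) = 0)
    (hXε : nMax19 F n K U₀ X < ε₄)
    (u : GaugeTransf (F.P K) 0 (Matrix.specialUnitaryGroup (Fin 2) ℂ)) (W : GaugeField (F.P K) 0 (Matrix.specialUnitaryGroup (Fin 2) ℂ))
    (hWdef : W = GaugeField.gaugeAct u (emb15 U₀ (expHermField X))) (hWfib : W ∈ fibre F ℰp n K hnK.le V)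
    {CP CL θ : ℝ} (hCP : 0 < CP) (hθ : θ ≤ 1 / 2)
    (hκ : 0 ≤ ((1 / 2 - θ) / CP - 96 * (178 * ε₄)) * (((F.L : ℝ) ^ (K - n)) ^ 2)⁻¹ - CL)
    (hrepr : ∀ W' : GaugeField (F.P K) 0 (Matrix.specialUnitaryGroup (Fin 2) ℂ), W' ∈ regFibrePr F n K hnK.le (178 * ε₄) V →
        ∃ g : GaugeTransf (F.P K) 0 (Matrix.specialUnitaryGroup (Fin 2) ℂ), descTransf F n K hnK.le g = (fun _ => 1) ∧
          (∑ b : PBond (F.P K) 0, ‖pertVar W (GaugeField.gaugeAct g W') b‖ ^ 2 ≤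
            CP * ((F.L : ℝ) ^ (K - n)) ^ 2 * ∑ p : Plaq (F.P K) 0,
              ‖((GaugeField.plaqHol (GaugeField.gaugeAct g W') p : Matrix.specialUnitaryGroup (Fin 2) ℂ) : Matrix (Fin 2) (Fin 2) ℂ)
                  * star ((GaugeField.plaqHol W p : Matrix.specialUnitaryGroup (Fin 2) ℂ) : Matrix (Fin 2) (Fin 2) ℂ) - 1‖ ^ 2) ∧
          (-(θ * ∑ p : Plaq (F.P K) 0,
              ‖((GaugeField.plaqHol (GaugeField.gaugeAct g W') p : Matrix.specialUnitaryGroup (Fin 2) ℂ) : Matrix (Fin 2) (Fin 2) ℂ)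
                  * star ((GaugeField.plaqHol W p : Matrix.specialUnitaryGroup (Fin 2) ℂ) : Matrix (Fin 2) (Fin 2) ℂ) - 1‖ ^ 2) -
              CL * ∑ b : PBond (F.P K) 0, ‖pertVar W (GaugeField.gaugeAct g W') b‖ ^ 2 ≤
            ∑ p : Plaq (F.P K) 0, (1 / 2) * ((((((GaugeField.plaqHol W p : Matrix.specialUnitaryGroup (Fin 2) ℂ) : Matrix (Fin 2) (Fin 2) ℂ)) - 1)ᴴ
              * (((((GaugeField.gaugeAct g W' ⟨p.src, p.μ⟩ : Matrix.specialUnitaryGroup (Fin 2) ℂ) : Matrix (Fin 2) (Fin 2) ℂ) * star (W ⟨p.src, p.μ⟩ : Matrix (Fin 2) (Fin 2) ℂ) - 1)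
                  + (W ⟨p.src, p.μ⟩ : Matrix (Fin 2) (Fin 2) ℂ)
                      * (((GaugeField.gaugeAct g W' ⟨p.src.shift p.μ, p.ν⟩ : Matrix.specialUnitaryGroup (Fin 2) ℂ) : Matrix (Fin 2) (Fin 2) ℂ) *
                          star (W ⟨p.src.shift p.μ, p.ν⟩ : Matrix (Fin 2) (Fin 2) ℂ) - 1)
                      * star (W ⟨p.src, p.μ⟩ : Matrix (Fin 2) (Fin 2) ℂ)
                  - ((W ⟨p.src, p.μ⟩ * W ⟨p.src.shift p.μ, p.ν⟩ * (W ⟨p.src.shift p.ν, p.μ⟩)⁻¹ : Matrix.specialUnitaryGroup (Fin 2) ℂ) :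
                        Matrix (Fin 2) (Fin 2) ℂ)
                      * (((GaugeField.gaugeAct g W' ⟨p.src.shift p.ν, p.μ⟩ : Matrix.specialUnitaryGroup (Fin 2) ℂ) : Matrix (Fin 2) (Fin 2) ℂ) *
                          star (W ⟨p.src.shift p.ν, p.μ⟩ : Matrix (Fin 2) (Fin 2) ℂ) - 1)
                      * star ((W ⟨p.src, p.μ⟩ * W ⟨p.src.shift p.μ, p.ν⟩ * (W ⟨p.src.shift p.ν, p.μ⟩)⁻¹ : Matrix.specialUnitaryGroup (Fin 2) ℂ) :
                        Matrix (Fin 2) (Fin 2) ℂ)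
                  - ((GaugeField.plaqHol W p : Matrix.specialUnitaryGroup (Fin 2) ℂ) : Matrix (Fin 2) (Fin 2) ℂ)
                      * (((GaugeField.gaugeAct g W' ⟨p.src, p.ν⟩ : Matrix.specialUnitaryGroup (Fin 2) ℂ) : Matrix (Fin 2) (Fin 2) ℂ) * star (W ⟨p.src, p.ν⟩ : Matrix (Fin 2) (Fin 2) ℂ) - 1)
                      * star ((GaugeField.plaqHol W p : Matrix.specialUnitaryGroup (Fin 2) ℂ) : Matrix (Fin 2) (Fin 2) ℂ))
                * ((GaugeField.plaqHol W p : Matrix.specialUnitaryGroup (Fin 2) ℂ) : Matrix (Fin 2) (Fin 2) ℂ))).trace).re)) :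
    ∀ X' : PBond (F.P K) 0 → Matrix (Fin 2) (Fin 2) ℂ, nMax19 F n K U₀ X' < ε₄ →
      (∀ b : PBond (F.P K) 0, (X' b).IsHermitian ∧ Matrix.trace (X' b) = 0) →
        AvgCondPrint F n K hnK.le V U₀ X' → IsLandauPrint F n K U₀ X' →
          wilsonAction4 (emb15 U₀ (expHermField X)) ≤ wilsonAction4 (emb15 U₀ (expHermField X')) := by
  intro X' hX'ε hX'h h20' _h21'
  -- (19) at ε₄ for both chart points; row D's engine: both composites lie in 𝔘_k(178ε₄)
  have h19 : In19 F n K ε₄ U₀ (expHermField X) X := in19_expHermField_of_nMax19_lt hXh hXε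
  have h19' : In19 F n K ε₄ U₀ (expHermField X') X' := in19_expHermField_of_nMax19_lt hX'h hX'ε
  have hε₄0 : 0 < ε₄ := pos_of_in19 h19
  have he0 : (0 : ℝ) ≤ 178 * ε₄ := by positivity
  have hRegW : RegPr F n K (178 * ε₄) W := by
    rw [hWdef]
    exact (regPr_gaugeAct_iff F he0 u _).mpr (regPr_emb15_of_in19 (F := F) (n := n) (K := K) hε₄ hlo hreg h19)
  have hWmem : W ∈ regFibrePr F n K hnK.le (178 * ε₄) V := (mem_regFibrePr_iff F).mpr ⟨hWfib, hRegW⟩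
  -- the growth input makes `W` a minimiser over (6)(178ε₄)
  have hWmin := isMinOn_regFibrePr_of_relSchemaThetaE_T3 F hnK.le he0 hCP hθ V hWmem hκ hrepr
  -- the competitor's axial representative in the fibre, regular at 178ε₄
  obtain ⟨u', _hu', _hax', hW'fib⟩ := h20' (expHermField X') h19'.2.1
  have hRegW' : RegPr F n K (178 * ε₄) (GaugeField.gaugeAct u' (emb15 U₀ (expHermField X'))) :=
    (regPr_gaugeAct_iff F he0 u' _).mpr (regPr_emb15_of_in19 (F := F) (n := n) (K := K) hε₄ hlo hreg h19')
  have hW'mem : GaugeField.gaugeAct u' (emb15 U₀ (expHermField X')) ∈ regFibrePr F n K hnK.le (178 * ε₄) V :=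
    (mem_regFibrePr_iff F).mpr ⟨hW'fib, hRegW'⟩
  have hcmp : wilsonAction4 W ≤ wilsonAction4 (GaugeField.gaugeAct u' (emb15 U₀ (expHermField X'))) := hWmin hW'mem
  -- gauge invariance of (5)
  have a1 : wilsonAction4 W = wilsonAction4 (emb15 U₀ (expHermField X)) := by
    rw [hWdef]; exact T4WilsonGaugeFlatDirection.wilsonAction_gaugeAct 1 u _
  have a2 : wilsonAction4 (GaugeField.gaugeAct u' (emb15 U₀ (expHermField X'))) = wilsonAction4 (emb15 U₀ (expHermField X')) :=
    T4WilsonGaugeFlatDirection.wilsonAction_gaugeAct 1 u' _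
  rw [← a1, ← a2]
  exact hcmp

/-! ## §2 The same with the representative UN-PINNED (OWNER RULING (HESS_W) 2026-08-28 02:40:40Z: the growth supply runs on the chord's FULL covariant Landau representative)

In `growth142_T3` the displayed growth input `hrepr` reads `∃ g, descTransf g = 1 ∧ (ii′) ∧ (iii′)`: the text pins the representative to print's group (4) (`g↓ = 1`), but the
pin is idle — the comparison `A(W) ≤ A(W′^g) = A(W′)` only uses the gauge invariance of (5) (`PV3E.isMinOn_regFibrePr_of_reprLe` takes any `v : GaugeTransf`).  The twin below
drops the pin, so that a supplier re-gauging each competitor by an ℓ²-optimal FULL covariant Landau `u` relative to `W` (`u↓ ≠ 1` in general; p1 RULING (HESS-R) 02:40:01Z: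
then HESS_W is `Prop7CovariantCoercivity.wilsonAction4_sub_background_ge_offKernel_T3` by name) discharges it as displayed. -/

/-- ★ **THE MINIMALITY HALF OF C-min FROM THE UN-PINNED GROWTH INPUTS** — as `growth142_T3`, conclusion VERBATIM the last clause of C-min, with the growth input
`hreprFull := ∀ W′ ∈ (6)(178ε₄) ∩ 𝔅_k(V), ∃ g : GaugeTransf` (ANY gauge transformation — no `descTransf g = 1`), `(ii′) ∧ (iii′)` at the background `W` for `Y = (W′^g)W^* − 1`,
`R_p = W′^g(∂p)W(∂p)^*`; `κ = ((½ − θ)/C_P − 96·178ε₄)·L^{−2(K−n)} − C_L ≥ 0`.  The representative (e.g. the chord's full covariant Landau gauge) is the supplier's choice;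
the binder `W ∈ 𝔅_k(V)` of `growth142_T3` is not needed in this direction and is dropped.
[cite: Balaban1985Variational, (141)-(142) p.299, Prop. 6 p.295, (19)-(21) p.281; Balaban1985RegularSpaces, Prop. 7 (1.144) p.100] -/
theorem growth142_T3_full (F : T3Family) {n K : ℕ} (hnK : n < K) {B₃ ε₁ ε₄ : ℝ} (hε₄ : ε₄ ≤ 1 / 4) (hlo : (F.L : ℝ) ^ 3 * B₃ * ε₁ ≤ ε₄)
    (V : GaugeField (F.P n) 0 (Matrix.specialUnitaryGroup (Fin 2) ℂ)) (U₀ : GaugeField (F.P K) 0 (Matrix.specialUnitaryGroup (Fin 2) ℂ))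
    (hreg : RegPr F n K ((F.L : ℝ) ^ 3 * B₃ * ε₁) U₀)
    (X : PBond (F.P K) 0 → Matrix (Fin 2) (Fin 2) ℂ) (hXh : ∀ b : PBond (F.P K) 0, (X b).IsHermitian ∧ Matrix.trace (X b) = 0)
    (hXε : nMax19 F n K U₀ X < ε₄)
    (u : GaugeTransf (F.P K) 0 (Matrix.specialUnitaryGroup (Fin 2) ℂ)) (W : GaugeField (F.P K) 0 (Matrix.specialUnitaryGroup (Fin 2) ℂ))
    (hWdef : W = GaugeField.gaugeAct u (emb15 U₀ (expHermField X)))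
    {CP CL θ : ℝ} (hCP : 0 < CP) (hθ : θ ≤ 1 / 2)
    (hκ : 0 ≤ ((1 / 2 - θ) / CP - 96 * (178 * ε₄)) * (((F.L : ℝ) ^ (K - n)) ^ 2)⁻¹ - CL)
    (hreprFull : ∀ W' : GaugeField (F.P K) 0 (Matrix.specialUnitaryGroup (Fin 2) ℂ), W' ∈ regFibrePr F n K hnK.le (178 * ε₄) V →
        ∃ g : GaugeTransf (F.P K) 0 (Matrix.specialUnitaryGroup (Fin 2) ℂ),
          (∑ b : PBond (F.P K) 0, ‖pertVar W (GaugeField.gaugeAct g W') b‖ ^ 2 ≤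
            CP * ((F.L : ℝ) ^ (K - n)) ^ 2 * ∑ p : Plaq (F.P K) 0,
              ‖((GaugeField.plaqHol (GaugeField.gaugeAct g W') p : Matrix.specialUnitaryGroup (Fin 2) ℂ) : Matrix (Fin 2) (Fin 2) ℂ)
                  * star ((GaugeField.plaqHol W p : Matrix.specialUnitaryGroup (Fin 2) ℂ) : Matrix (Fin 2) (Fin 2) ℂ) - 1‖ ^ 2) ∧
          (-(θ * ∑ p : Plaq (F.P K) 0,
              ‖((GaugeField.plaqHol (GaugeField.gaugeAct g W') p : Matrix.specialUnitaryGroup (Fin 2) ℂ) : Matrix (Fin 2) (Fin 2) ℂ)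
                  * star ((GaugeField.plaqHol W p : Matrix.specialUnitaryGroup (Fin 2) ℂ) : Matrix (Fin 2) (Fin 2) ℂ) - 1‖ ^ 2) -
              CL * ∑ b : PBond (F.P K) 0, ‖pertVar W (GaugeField.gaugeAct g W') b‖ ^ 2 ≤
            ∑ p : Plaq (F.P K) 0, (1 / 2) * ((((((GaugeField.plaqHol W p : Matrix.specialUnitaryGroup (Fin 2) ℂ) : Matrix (Fin 2) (Fin 2) ℂ)) - 1)ᴴ
              * (((((GaugeField.gaugeAct g W' ⟨p.src, p.μ⟩ : Matrix.specialUnitaryGroup (Fin 2) ℂ) : Matrix (Fin 2) (Fin 2) ℂ) * star (W ⟨p.src, p.μ⟩ : Matrix (Fin 2) (Fin 2) ℂ) - 1)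
                  + (W ⟨p.src, p.μ⟩ : Matrix (Fin 2) (Fin 2) ℂ)
                      * (((GaugeField.gaugeAct g W' ⟨p.src.shift p.μ, p.ν⟩ : Matrix.specialUnitaryGroup (Fin 2) ℂ) : Matrix (Fin 2) (Fin 2) ℂ) *
                          star (W ⟨p.src.shift p.μ, p.ν⟩ : Matrix (Fin 2) (Fin 2) ℂ) - 1)
                      * star (W ⟨p.src, p.μ⟩ : Matrix (Fin 2) (Fin 2) ℂ)
                  - ((W ⟨p.src, p.μ⟩ * W ⟨p.src.shift p.μ, p.ν⟩ * (W ⟨p.src.shift p.ν, p.μ⟩)⁻¹ : Matrix.specialUnitaryGroup (Fin 2) ℂ) :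
                        Matrix (Fin 2) (Fin 2) ℂ)
                      * (((GaugeField.gaugeAct g W' ⟨p.src.shift p.ν, p.μ⟩ : Matrix.specialUnitaryGroup (Fin 2) ℂ) : Matrix (Fin 2) (Fin 2) ℂ) *
                          star (W ⟨p.src.shift p.ν, p.μ⟩ : Matrix (Fin 2) (Fin 2) ℂ) - 1)
                      * star ((W ⟨p.src, p.μ⟩ * W ⟨p.src.shift p.μ, p.ν⟩ * (W ⟨p.src.shift p.ν, p.μ⟩)⁻¹ : Matrix.specialUnitaryGroup (Fin 2) ℂ) :
                        Matrix (Fin 2) (Fin 2) ℂ)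
                  - ((GaugeField.plaqHol W p : Matrix.specialUnitaryGroup (Fin 2) ℂ) : Matrix (Fin 2) (Fin 2) ℂ)
                      * (((GaugeField.gaugeAct g W' ⟨p.src, p.ν⟩ : Matrix.specialUnitaryGroup (Fin 2) ℂ) : Matrix (Fin 2) (Fin 2) ℂ) * star (W ⟨p.src, p.ν⟩ : Matrix (Fin 2) (Fin 2) ℂ) - 1)
                      * star ((GaugeField.plaqHol W p : Matrix.specialUnitaryGroup (Fin 2) ℂ) : Matrix (Fin 2) (Fin 2) ℂ))
                * ((GaugeField.plaqHol W p : Matrix.specialUnitaryGroup (Fin 2) ℂ) : Matrix (Fin 2) (Fin 2) ℂ))).trace).re)) :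
    ∀ X' : PBond (F.P K) 0 → Matrix (Fin 2) (Fin 2) ℂ, nMax19 F n K U₀ X' < ε₄ →
      (∀ b : PBond (F.P K) 0, (X' b).IsHermitian ∧ Matrix.trace (X' b) = 0) →
        AvgCondPrint F n K hnK.le V U₀ X' → IsLandauPrint F n K U₀ X' →
          wilsonAction4 (emb15 U₀ (expHermField X)) ≤ wilsonAction4 (emb15 U₀ (expHermField X')) := by
  intro X' hX'ε hX'h h20' _h21'
  -- (19) at ε₄ for both chart points; row D's engine: both composites lie in 𝔘_k(178ε₄)
  have h19 : In19 F n K ε₄ U₀ (expHermField X) X := in19_expHermField_of_nMax19_lt hXh hXε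
  have h19' : In19 F n K ε₄ U₀ (expHermField X') X' := in19_expHermField_of_nMax19_lt hX'h hX'ε
  have hε₄0 : 0 < ε₄ := pos_of_in19 h19
  have he0 : (0 : ℝ) ≤ 178 * ε₄ := by positivity
  have hRegW : RegPr F n K (178 * ε₄) W := by
    rw [hWdef]
    exact (regPr_gaugeAct_iff F he0 u _).mpr (regPr_emb15_of_in19 (F := F) (n := n) (K := K) hε₄ hlo hreg h19)
  -- the UNPINNED growth input makes `W` a minimiser over (6)(178ε₄): any representative `g` will do, by gauge invariance of (5)
  have hWmin : IsMinOn (fun W' : GaugeField (F.P K) 0 (Matrix.specialUnitaryGroup (Fin 2) ℂ) => wilsonAction4 W')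
      (regFibrePr F n K hnK.le (178 * ε₄) V) W := by
    refine Summit.QuantumFields.YangMills.Theorems.PV3E.isMinOn_regFibrePr_of_reprLe F hnK.le V W fun W' hW' => ?_
    obtain ⟨g, hP, hlin⟩ := hreprFull W' hW'
    refine ⟨g, ?_⟩
    have hY : ∀ b : PBond (F.P K) 0, pertVar W (GaugeField.gaugeAct g W') b =
        ((GaugeField.gaugeAct g W' b : Matrix.specialUnitaryGroup (Fin 2) ℂ) : Matrix (Fin 2) (Fin 2) ℂ) * star (W b : Matrix (Fin 2) (Fin 2) ℂ) - 1 :=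
      fun b => Summit.QuantumFields.YangMills.Theorems.Prop7BlendClause1.pertVar_eq_mul_star W (GaugeField.gaugeAct g W') b
    simp only [hY] at hP hlin
    have hG := Summit.QuantumFields.YangMills.Theorems.Prop7ExactExpansion.growth_of_relPoincare_theta_T3 F n K (GaugeField.gaugeAct g W') W he0 hCP hθ
      (Summit.QuantumFields.YangMills.Theorems.Prop7BlendClause1.plaq_le_of_regPr F hRegW) hP hlin
    have hS : 0 ≤ ∑ b : PBond (F.P K) 0,
        ‖((GaugeField.gaugeAct g W' b : Matrix.specialUnitaryGroup (Fin 2) ℂ) : Matrix (Fin 2) (Fin 2) ℂ) * star (W b : Matrix (Fin 2) (Fin 2) ℂ) - 1‖ ^ 2 :=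
      Finset.sum_nonneg fun _ _ => sq_nonneg _
    have hκS := mul_nonneg hκ hS
    linarith
  -- the competitor's axial representative in the fibre, regular at 178ε₄
  obtain ⟨u', _hu', _hax', hW'fib⟩ := h20' (expHermField X') h19'.2.1
  have hRegW' : RegPr F n K (178 * ε₄) (GaugeField.gaugeAct u' (emb15 U₀ (expHermField X'))) :=
    (regPr_gaugeAct_iff F he0 u' _).mpr (regPr_emb15_of_in19 (F := F) (n := n) (K := K) hε₄ hlo hreg h19')
  have hW'mem : GaugeField.gaugeAct u' (emb15 U₀ (expHermField X')) ∈ regFibrePr F n K hnK.le (178 * ε₄) V :=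
    (mem_regFibrePr_iff F).mpr ⟨hW'fib, hRegW'⟩
  have hcmp : wilsonAction4 W ≤ wilsonAction4 (GaugeField.gaugeAct u' (emb15 U₀ (expHermField X'))) := hWmin hW'mem
  -- gauge invariance of (5)
  have a1 : wilsonAction4 W = wilsonAction4 (emb15 U₀ (expHermField X)) := by
    rw [hWdef]; exact T4WilsonGaugeFlatDirection.wilsonAction_gaugeAct 1 u _
  have a2 : wilsonAction4 (GaugeField.gaugeAct u' (emb15 U₀ (expHermField X'))) = wilsonAction4 (emb15 U₀ (expHermField X')) :=
    T4WilsonGaugeFlatDirection.wilsonAction_gaugeAct 1 u' _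
  rw [← a1, ← a2]
  exact hcmp

end Summit.QuantumFields.YangMills.Theorems.Prop7Growth142T3

end
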